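import Literature.MathematicalPhysics.QuantumLattice.EmeryThreeBandClusterFloor
import Literature.MathematicalPhysics.QuantumLattice.WeightedOpenClusterUniformWeights
import HarnessLib

/-!
# The UNIFORM `L_q`-admissible weight of a window (superlattice placements) — turnkey weighted-cluster floors for
# superlattice-periodic models, and the Emery cluster floor with inverse covering multiplicities

Topic `Literature/MathematicalPhysics/QuantumLattice` (family `hubbard`; crew hubbard-fast S2 (iv) «multi-band / decorated models»).
`WeightedOpenClusterBoundsPeriodic` bounds the cell energy density (T = 0) and the periodic pressure (T > 0) of a `q`-periodic interaction from ONE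
weighted open cluster, for every `L_q`-ADMISSIBLE weight; `EmeryThreeBandClusterFloor` specialises the floor to the typed three-band density.
This file supplies the canonical `L_q`-admissible weight (the periodic twin of `WeightedOpenClusterUniformWeights`):

* `superlatPlacements q B Y` — the placements `v` of the shape `Y` inside the window `B` (`Y + v ⊆ B`) that are SUPERLATTICE vectors
  (`v ∈ L_q`, written `InCoset q 0 v`); `superlatPlacementCount`; invariance under `L_q`-translations of the shape
  (`superlatPlacementCount_shiftSet_of_inCoset`) and the rooted count `= #{y ∈ B : res y = c, X + (y − pos c) ⊆ B}` for `X ∋ pos c`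
  (`superlatPlacementCount_eq_card_filter`);
* `uniformPeriodicWeight q B M Y = M / superlatPlacementCount q B Y` — **`L_q`-admissible of mass `M`** for every interaction all of whose
  interacting shapes rooted at cell points have a superlattice translate inside `B` (`uniformPeriodicWeight_admissible`); `= 0` on `∅`;
* turnkey: **`IsPeriodic.le_mul_cellMeanEnergy_of_posSemidef_uniformPeriodicWeight`** (any `q`-periodic model) and
  **`le_emeryEnergyDensity_of_posSemidef_uniform`**: for a window `B ⊆ ℤ²` containing an even translate of every interacting rooted shape of
  `emeryInteraction θ`, a certificate `H^{w}_B[emeryInteraction θ] + G − q₀·1 ⪰ 0` with the uniform weight of mass `M > 0` and `G` killed by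
  `2×2`-periodic states gives `q₀/(4M) ≤ emeryEnergyDensity θ ρ` (e.g. the 7-site `Cu₃O₄` ring window
  `{(0,0),(1,0),(2,0),(0,1),(2,1),(0,2),(1,2)}`, Fock dimension `4⁷`, contains an even translate of every Cu–O, O–O bond class and every site class).

Definitions with bodies: `superlatPlacements`, `superlatPlacementCount`, `uniformPeriodicWeight`; everything else PROVED; no named fact, no number.

## Mathlib / tree search

REUSED: `placements`, `mem_placements_iff` (`WeightedOpenClusterUniformWeights`); `InCoset`, `inCoset_cellPos_iff_eq_cellRes` (`SublatticeSelectiveInteractions`,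
`PeriodicSublatticeAndStaggeredTerms`); `cellPos`, `cellRes`; `IsPeriodic.le_mul_cellMeanEnergy_of_posSemidef_reweight` (`WeightedOpenClusterBoundsPeriodic`);
`le_emeryEnergyDensity_of_posSemidef_reweight` (`EmeryThreeBandClusterFloor`); `mem_shiftSet`, `KrausPattern.shiftSet_shiftSet_neg`.
`lean search 'superlatPlacement|uniformPeriodicWeight'` (2026-08-28): nothing.

## References

* R. Valentí, J. Stolze, P. J. Hirschfeld, Phys. Rev. B 43 (1991) 13743, §II (inverse covering multiplicities). [cite: ValentiStolzeHirschfeld1991, §II]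
* P. W. Anderson, Phys. Rev. 83 (1951) 1260, eq. (2). [cite: Anderson1951, eq. (2)]
* H. Araki, H. Moriya, Rev. Math. Phys. 15 (2003) 93, §4.1 Def. 4.5. [cite: ArakiMoriya2003, §4.1 Def. 4.5]
-/

noncomputable section

open scoped ComplexOrder BigOperators
open Finset

namespace Literature.MathematicalPhysics.QuantumLattice

open Matrix HubbardWave0 Literature.Probability.LatticeModels ThermodynamicLimit
open scoped Matrix.Norms.L2Operator

variable {d : ℕ}

/-! ### §1 Superlattice placements of a shape inside a window -/

/-- `v ∈ L_q` as a coset condition: `InCoset q 0 v ↔ ∀ i, (q_i+1) ∣ v_i`. [cite: ArakiMoriya2003, §4.1] -/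
theorem inCoset_zero_iff_dvd (q : Fin d → ℕ) (v : Site d) : InCoset q 0 v ↔ ∀ i, ((q i : ℤ) + 1) ∣ v i := by
  refine forall_congr' fun i => ?_
  rw [Pi.zero_apply, sub_zero, Int.dvd_iff_emod_eq_zero]

/-- `L_q` is closed under addition. [cite: ArakiMoriya2003, §4.1] -/
theorem inCoset_zero_add {q : Fin d → ℕ} {u v : Site d} (hu : InCoset q 0 u) (hv : InCoset q 0 v) : InCoset q 0 (u + v) := by
  rw [inCoset_zero_iff_dvd] at hu hv ⊢
  exact fun i => by rw [Pi.add_apply]; exact dvd_add (hu i) (hv i)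

/-- `L_q` is closed under negation. [cite: ArakiMoriya2003, §4.1] -/
theorem inCoset_zero_neg {q : Fin d → ℕ} {u : Site d} (hu : InCoset q 0 u) : InCoset q 0 (-u) := by
  rw [inCoset_zero_iff_dvd] at hu ⊢
  exact fun i => by rw [Pi.neg_apply]; exact (hu i).neg_right

/-- **`res y = c` iff `y − pos c ∈ L_q`.** [cite: ArakiMoriya2003, §4.1] -/
theorem cellRes_eq_iff_inCoset_zero_sub (q : Fin d → ℕ) (y : Site d) (c : Cell q) :
    InfVolFermionState.cellRes q y = c ↔ InCoset q 0 (y - cellPos c) := by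
  rw [eq_comm, ← inCoset_cellPos_iff_eq_cellRes, inCoset_zero_iff_dvd]
  refine forall_congr' fun i => ?_
  rw [Pi.sub_apply, ← Int.dvd_iff_emod_eq_zero, dvd_sub_comm]

/-- **The superlattice placements of a shape inside a window**: the `v ∈ L_q` with `Y + v ⊆ B`. [cite: ValentiStolzeHirschfeld1991, §II] -/
def superlatPlacements (q : Fin d → ℕ) (B Y : Finset (Site d)) : Finset (Site d) :=
  (placements B Y).filter fun v => InCoset q 0 v

/-- **Their number** (the superlattice covering multiplicity of the shape `Y` by the cluster `B`). [cite: ValentiStolzeHirschfeld1991, §II] -/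
def superlatPlacementCount (q : Fin d → ℕ) (B Y : Finset (Site d)) : ℕ := (superlatPlacements q B Y).card

/-- Membership, for nonempty shapes. [cite: ValentiStolzeHirschfeld1991, §II] -/
theorem mem_superlatPlacements_iff {q : Fin d → ℕ} {B Y : Finset (Site d)} (hY : Y.Nonempty) {v : Site d} :
    v ∈ superlatPlacements q B Y ↔ shiftSet v Y ⊆ B ∧ InCoset q 0 v := by
  rw [superlatPlacements, Finset.mem_filter, mem_placements_iff hY]

/-- `superlatPlacementCount q B ∅ = 0`. [cite: ValentiStolzeHirschfeld1991, §II] -/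
theorem superlatPlacementCount_empty (q : Fin d → ℕ) (B : Finset (Site d)) : superlatPlacementCount q B (∅ : Finset (Site d)) = 0 := by
  rw [superlatPlacementCount, superlatPlacements, placements_empty, Finset.filter_empty, Finset.card_empty]

/-- Composition of translations: `(Y + u) + v = Y + (v + u)`. [folklore] -/
private theorem shiftSet_shiftSet_eq_shiftSet_add' (v u : Site d) (Y : Finset (Site d)) :
    shiftSet v (shiftSet u Y) = shiftSet (v + u) Y := by
  ext x
  simp only [mem_shiftSet, sub_sub]

/-- **Invariance under superlattice translations of the shape**: `count(Y + u) = count(Y)` for `u ∈ L_q`. [cite: ValentiStolzeHirschfeld1991, §II] -/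
theorem superlatPlacementCount_shiftSet_of_inCoset {q : Fin d → ℕ} (B Y : Finset (Site d)) {u : Site d} (hu : InCoset q 0 u) :
    superlatPlacementCount q B (shiftSet u Y) = superlatPlacementCount q B Y := by
  rcases Y.eq_empty_or_nonempty with rfl | hY
  · have h : shiftSet u (∅ : Finset (Site d)) = ∅ := by rw [shiftSet_eq_map, Finset.map_empty]
    rw [h]
  · have hY' : (shiftSet u Y).Nonempty := by
      obtain ⟨y, hy⟩ := hY
      exact ⟨y + u, by rw [mem_shiftSet, add_sub_cancel_right]; exact hy⟩
    rw [superlatPlacementCount, superlatPlacementCount]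
    refine Finset.card_nbij' (fun v => v + u) (fun v => v - u) (fun v hv => ?_) (fun v hv => ?_) (fun v _ => add_sub_cancel_right v u)
      (fun v _ => sub_add_cancel v u)
    · rw [Finset.mem_coe, mem_superlatPlacements_iff hY'] at hv
      rw [Finset.mem_coe, mem_superlatPlacements_iff hY, ← shiftSet_shiftSet_eq_shiftSet_add']
      exact ⟨hv.1, inCoset_zero_add hv.2 hu⟩
    · rw [Finset.mem_coe, mem_superlatPlacements_iff hY] at hv
      rw [Finset.mem_coe, mem_superlatPlacements_iff hY', shiftSet_shiftSet_eq_shiftSet_add', sub_add_cancel]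
      refine ⟨hv.1, ?_⟩
      have h := inCoset_zero_add hv.2 (inCoset_zero_neg hu)
      rwa [← sub_eq_add_neg] at h

/-- **Shapes rooted at a cell point**: for `X ∋ pos c`, the superlattice placements of `X` inside `B` correspond to the sites `y ∈ B` with
`res y = c` and `X + (y − pos c) ⊆ B` (`y = pos c + v`). [cite: ValentiStolzeHirschfeld1991, §II] -/
theorem superlatPlacementCount_eq_card_filter {q : Fin d → ℕ} {B X : Finset (Site d)} {c : Cell q} (hc : cellPos c ∈ X) :
    superlatPlacementCount q B X =
      (B.filter fun y => InfVolFermionState.cellRes q y = c ∧ shiftSet (y - cellPos c) X ⊆ B).card := by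
  rw [superlatPlacementCount]
  refine Finset.card_nbij' (fun v => cellPos c + v) (fun y => y - cellPos c) (fun v hv => ?_) (fun y hy => ?_)
    (fun v _ => add_sub_cancel_left (cellPos c) v) (fun y _ => add_sub_cancel (cellPos c) y)
  · rw [Finset.mem_coe, mem_superlatPlacements_iff ⟨_, hc⟩] at hv
    rw [Finset.mem_coe, Finset.mem_filter, cellRes_eq_iff_inCoset_zero_sub, add_sub_cancel_left]
    exact ⟨hv.1 (by rw [mem_shiftSet, add_sub_cancel_right]; exact hc), hv.2, hv.1⟩
  · rw [Finset.mem_coe, Finset.mem_filter, cellRes_eq_iff_inCoset_zero_sub] at hy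
    rw [Finset.mem_coe, mem_superlatPlacements_iff ⟨_, hc⟩]
    exact ⟨hy.2.2, hy.2.1⟩

/-! ### §2 The uniform periodic weight and its admissibility -/

/-- **The uniform `L_q`-weight of mass `M`**: `w(Y) = M / #{superlattice translates of Y inside B}` (`0` where there is none, e.g. on `∅`).
[cite: ValentiStolzeHirschfeld1991, §II] -/
def uniformPeriodicWeight (q : Fin d → ℕ) (B : Finset (Site d)) (M : ℝ) (Y : Finset (Site d)) : ℝ := M / superlatPlacementCount q B Y

/-- No constant term: `w(∅) = 0`. [cite: ValentiStolzeHirschfeld1991, §II] -/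
theorem uniformPeriodicWeight_empty (q : Fin d → ℕ) (B : Finset (Site d)) (M : ℝ) :
    uniformPeriodicWeight q B M (∅ : Finset (Site d)) = 0 := by
  rw [uniformPeriodicWeight, superlatPlacementCount_empty, Nat.cast_zero, div_zero]

/-- **THE UNIFORM PERIODIC WEIGHT IS `L_q`-ADMISSIBLE** for every interaction all of whose interacting shapes rooted at cell points have a
superlattice translate inside `B`. [cite: ValentiStolzeHirschfeld1991, §II] -/
theorem uniformPeriodicWeight_admissible {q : Fin d → ℕ} {Ψ : FermionInteraction d} (B : Finset (Site d)) (M : ℝ)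
    (hfit : ∀ (c : Cell q) (X : Finset (Site d)), cellPos c ∈ X → Ψ.Φ X ≠ 0 → ∃ v : Site d, InCoset q 0 v ∧ shiftSet v X ⊆ B) :
    ∀ (c : Cell q) (X : Finset (Site d)), cellPos c ∈ X → Ψ.Φ X ≠ 0 →
      ∑ y ∈ B with (InfVolFermionState.cellRes q y = c ∧ shiftSet (y - cellPos c) X ⊆ B),
        uniformPeriodicWeight q B M (shiftSet (y - cellPos c) X) = M := by
  intro c X hc hΦ
  have hterm : ∀ y ∈ B.filter (fun y => InfVolFermionState.cellRes q y = c ∧ shiftSet (y - cellPos c) X ⊆ B),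
      uniformPeriodicWeight q B M (shiftSet (y - cellPos c) X) = M / superlatPlacementCount q B X := by
    intro y hy
    rw [Finset.mem_filter, cellRes_eq_iff_inCoset_zero_sub] at hy
    rw [uniformPeriodicWeight, superlatPlacementCount_shiftSet_of_inCoset B X hy.2.1]
  rw [Finset.sum_congr rfl hterm, Finset.sum_const, nsmul_eq_mul, ← superlatPlacementCount_eq_card_filter hc]
  have hpos : (0 : ℝ) < superlatPlacementCount q B X := by
    obtain ⟨v, hv, hvB⟩ := hfit c X hc hΦ
    rw [superlatPlacementCount]
    exact_mod_cast Finset.card_pos.2 ⟨v, (mem_superlatPlacements_iff ⟨_, hc⟩).2 ⟨hvB, hv⟩⟩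
  field_simp

/-! ### §3 Turnkey floors -/

namespace InfVolFermionState

/-- **T = 0, uniform periodic weight, any `q`-periodic model**: a certificate `H^{w}_B + G − q₀·1 ⪰ 0` with the uniform `L_q`-weight of mass `M`
(`G` killed by `q`-periodic states) gives `q₀ ≤ M·|C|·ē_q(ω)` for every `q`-periodic `ω`, provided every interacting rooted shape has a superlattice
translate inside `B`. [cite: Anderson1951, eq. (2)] [cite: ValentiStolzeHirschfeld1991, §II] -/
theorem IsPeriodic.le_mul_cellMeanEnergy_of_posSemidef_uniformPeriodicWeight {q : Fin d → ℕ} {Ψ : FermionInteraction d} {R : ℝ}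
    {ω : InfVolFermionState d} (hω : ω.IsPeriodic q) (hΨ : Ψ.IsPeriodic q) (hR : Ψ.HasFiniteRange R) (B : Finset (Site d)) (M : ℝ)
    (hfit : ∀ (c : Cell q) (X : Finset (Site d)), cellPos c ∈ X → Ψ.Φ X ≠ 0 → ∃ v : Site d, InCoset q 0 v ∧ shiftSet v X ⊆ B)
    {G : FermionOp B} (hG0 : ∀ ω' : InfVolFermionState d, ω'.IsPeriodic q → (ω'.expect B G).re = 0) {q₀ : ℝ}
    (hq : ((⟨fun X => (uniformPeriodicWeight q B M X : ℂ) • Ψ.Φ X⟩ : FermionInteraction d).localHamiltonian B + G -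
      (q₀ : ℂ) • (1 : FermionOp B)).PosSemidef) :
    q₀ ≤ M * (Fintype.card (Cell q) : ℝ) * cellMeanEnergy q Ψ ω R := by
  have h := hω.le_mul_cellMeanEnergy_of_posSemidef_reweight hΨ hR B (uniformPeriodicWeight q B M) M
    (uniformPeriodicWeight_admissible B M hfit) hG0 hq
  rwa [uniformPeriodicWeight_empty, zero_mul, sub_zero] at h

/-- **THE EMERY CLUSTER FLOOR WITH INVERSE COVERING MULTIPLICITIES.** For a window `B ⊆ ℤ²` containing an even (`∈ (2ℤ)²`) translate of every
interacting shape of `emeryInteraction θ` rooted at a cell point, the uniform `(2ℤ)²`-weight `w` of mass `M > 0`, any `G ∈ 𝔄_B` killed by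
`2×2`-periodic states, and a certificate `H^{w}_B[emeryInteraction θ] + G − q₀·1 ⪰ 0`: `q₀/(4M) ≤ emeryEnergyDensity θ ρ` (every `ρ` with a
nonempty class). [cite: Anderson1951, eq. (2)] [cite: ValentiStolzeHirschfeld1991, §II] -/
theorem le_emeryEnergyDensity_of_posSemidef_uniform (θ : Fin 14 → ℝ) {ρ : ℝ} (hS : (emeryStates ρ).Nonempty) (B : Finset (Site 2))
    {M : ℝ} (hM : 0 < M)
    (hfit : ∀ (c : Cell liebPeriods) (X : Finset (Site 2)), cellPos c ∈ X → (emeryInteraction θ).Φ X ≠ 0 →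
      ∃ v : Site 2, InCoset liebPeriods 0 v ∧ shiftSet v X ⊆ B)
    {G : FermionOp B} (hG0 : ∀ ω' : InfVolFermionState 2, ω'.IsPeriodic liebPeriods → (ω'.expect B G).re = 0) {q₀ : ℝ}
    (hq : ((⟨fun X => (uniformPeriodicWeight liebPeriods B M X : ℂ) • (emeryInteraction θ).Φ X⟩ : FermionInteraction 2).localHamiltonian B +
      G - (q₀ : ℂ) • (1 : FermionOp B)).PosSemidef) :
    q₀ / (4 * M) ≤ emeryEnergyDensity θ ρ := by
  have h := le_emeryEnergyDensity_of_posSemidef_reweight θ hS B (uniformPeriodicWeight liebPeriods B M) hM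
    (uniformPeriodicWeight_admissible B M hfit) hG0 hq
  rwa [uniformPeriodicWeight_empty, zero_mul, sub_zero] at h

end InfVolFermionState

end Literature.MathematicalPhysics.QuantumLattice

end
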